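import Summits.BirchSwinnertonDyer.BirchSwinnertonDyer.Theorems.AdditiveBranchIMCTwistRootNumberTwistedNonsplit
import Summits.BirchSwinnertonDyer.BirchSwinnertonDyer.Theorems.AdditiveBranchIMCTwistRootNumberTwistedField
import Summits.BirchSwinnertonDyer.Rank1Residual.AdditivePotMult.QuadraticTwistTamagawaMultiplicative
import Literature.NumberTheory.EllipticCurves.BSDSelmerSkinnerThmBProofs
import Literature.NumberTheory.EllipticCurves.PAdicBSDSplitMultiplicativeProofs
import Literature.NumberTheory.EllipticCurves.TamagawaPrimesEquivProofs
import HarnessLib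

/-!
# The E3′ CLASS CLAUSE in geometric form (both classes) and `w(E^{(d_K)}) = −w(E)` for EVERY twisted road field (no additive `2`)
# (brick E3′ of crux 19357 / 19358; LEAD g15)

Theorems only (no definition, no named fact, no `sorry`). The class clause `NonsplitClassAt W ℓ₀ K` of the twisted road
(`d_K = ℓ₀*·m`, `(m/ℓ₀) = −1` if `W₁ = E^{(ℓ₀*)}` is SPLIT multiplicative at `ℓ₀`, `+1` if it is non-split; sketch
`Cruxes/GordTwoRankOne/TwistedWanSketch.lean` v4, skeleton 19357 v37) says, in both classes, that the rank-one partner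
`E^{(d_K)} = W₁^{(m)}` — a twist of the multiplicative curve `W₁` by the `ℓ₀`-adic UNIT `m` — is NON-SPLIT multiplicative at `ℓ₀`:
a unit twist keeps multiplicative reduction and is split iff (`m̄` is a square ⟺ `W₁` is split)
(`Rank1Residual.AdditivePotMult.hasMultiplicativeReductionAt_and_split_iff_quadraticTwist_of_not_dvd`, Silverman *AEC* Ex. 10.16).
Feeding this to the both-classes engine `TwistRootNumberTwisted.rootNumber_quadraticTwist_eq_neg_of_potMult_nonsplit` (p796897) gives the
sketch statement `EngineTwisted` for every twisted road field, with the one residual hypothesis «`E` not additive at `2`».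

* `quadraticTwist_discr_nonsplit_at_of_nonsplitClass` — a globally minimal model `Wd` of `E^{(d_K)}` is multiplicative and NOT split at
  `ℓ₀` (both classes; case A was `quadraticTwist_discr_nonsplit_at_of_caseA`, p796997);
* `rootNumber_quadraticTwist_discr_eq_neg_of_twistedRoadField` — `w(E^{(d_K)}) = −w(E)` for `K` imaginary quadratic with `ℓ₀ ∣ d_K`
  in the non-split class, every bad prime `≠ ℓ₀` split, `2` split if `2 ∤ N_E`, `E` not additive at `2` (both classes).

BSD is proved for no curve by any of this.
References: [SilvermanAEC2009] VII.5 Prop. 5.1, X.5 Cor. 5.4, Ex. 10.16; [Rohrlich1993Compositio] Prop. 2–3; [AtkinLi1978] §1, §3.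
-/

set_option linter.dupNamespace false
set_option autoImplicit false

noncomputable section

open scoped Classical

open Literature.NumberTheory.EllipticCurves Literature.NumberTheory.EllipticCurves.ModularForms
  IsDedekindDomain IsDedekindDomain.HeightOneSpectrum NumberField Rat.HeightOneSpectrum WeierstrassCurve
  Literature.NumberTheory.QuadraticFields Literature.NumberTheory.EllipticCurves.Rank1Residual
  Summit.BirchSwinnertonDyer.Rank1Residual
  Summit.BirchSwinnertonDyer.BirchSwinnertonDyer.Theorems

namespace Summit.BirchSwinnertonDyer.BirchSwinnertonDyer.Theorems.TwistRootNumberTwisted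

variable (W : WeierstrassCurve ℚ) [W.IsElliptic] [W.IsGloballyMinimal]

omit [W.IsGloballyMinimal] in
/-- **The class clause in geometric form, both classes.** Let `ℓ₀` be an odd prime at which `W₁ = E^{(ℓ₀*)}` is multiplicative, `K`
imaginary quadratic with `ℓ₀ ∣ d_K` and `(d_K/ℓ₀* / ℓ₀) = −1` or `+1` according as `W₁` is split or not at `ℓ₀`, and `Wd` a globally
minimal model of `E^{(d_K)}`. Then `Wd` is multiplicative and NOT split at `ℓ₀`. [cite: SilvermanAEC2009, VII.5 Prop. 5.1(b), X.5 Cor. 5.4 and Ex. 10.16] -/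
theorem quadraticTwist_discr_nonsplit_at_of_nonsplitClass {ℓ₀ : ℕ} [hℓ₀ : Fact ℓ₀.Prime] (hℓ₀2 : ℓ₀ ≠ 2)
    (hmult₀ : (W.quadraticTwist (((-1 : ℤ) ^ (ℓ₀ / 2) * ℓ₀ : ℤ) : ℚ)).HasMultiplicativeReductionAtPrime ℓ₀)
    (K : Type) [Field K] [NumberField K] (hK : IsImaginaryQuadratic K)
    (hℓ₀K : (ℓ₀ : ℤ) ∣ NumberField.discr K)
    (hclass : legendreSym ℓ₀ (NumberField.discr K / ((-1 : ℤ) ^ (ℓ₀ / 2) * ℓ₀)) =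
      (if (W.quadraticTwist (((-1 : ℤ) ^ (ℓ₀ / 2) * ℓ₀ : ℤ) : ℚ)).HasSplitMultiplicativeReductionAtPrime ℓ₀ then -1 else 1))
    (Wd : WeierstrassCurve ℚ) [Wd.IsElliptic] [Wd.IsGloballyMinimal]
    (hWd : ∃ C : VariableChange ℚ, C • W.quadraticTwist (NumberField.discr K : ℚ) = Wd) :
    Wd.HasMultiplicativeReductionAtPrime ℓ₀ ∧ ¬ Wd.HasSplitMultiplicativeReductionAtPrime ℓ₀ := by
  -- the place of `𝓞 ℚ` over `ℓ₀`
  obtain ⟨w, hw⟩ : ∃ w : HeightOneSpectrum (𝓞 ℚ), (primesEquiv w : ℕ) = ℓ₀ :=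
    ⟨(primesEquiv (R := 𝓞 ℚ)).symm ⟨ℓ₀, hℓ₀.out⟩, by simp⟩
  set D : ℤ := NumberField.discr K with hD
  set s : ℤ := (-1 : ℤ) ^ (ℓ₀ / 2) * ℓ₀ with hs
  have h2K : Module.finrank ℚ K = 2 := hK.1
  have hs0 : s ≠ 0 := mul_ne_zero (pow_ne_zero _ (by norm_num)) (by exact_mod_cast hℓ₀.out.ne_zero)
  have hsD : s ∣ D := ((isUnit_neg_one (α := ℤ)).pow (ℓ₀ / 2)).mul_left_dvd.mpr hℓ₀K
  set m : ℤ := D / s with hm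
  have hDm : D = s * m := (Int.mul_ediv_cancel' hsD).symm
  have hℓ₀m : ¬ (ℓ₀ : ℤ) ∣ m := by
    rintro ⟨t, ht⟩
    have hsq : ((ℓ₀ : ℕ) : ℤ) ^ 2 ∣ NumberField.discr K := by
      refine ⟨(-1 : ℤ) ^ (ℓ₀ / 2) * t, ?_⟩
      rw [← hD, hDm, ht, hs]; ring
    exact Quadratic.not_sq_dvd_discr_of_prime_ne_two h2K hℓ₀.out hℓ₀2 hsq
  have hm0 : m ≠ 0 := by rintro h; exact hℓ₀m (by rw [h]; exact dvd_zero _)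
  have hmQ : (m : ℚ) ≠ 0 := by exact_mod_cast hm0
  have hDQ : (D : ℚ) ≠ 0 := by exact_mod_cast NumberField.discr_ne_zero K
  -- the curves
  set W₁ := W.quadraticTwist ((s : ℤ) : ℚ) with hW₁
  haveI : W₁.IsElliptic := W.isElliptic_quadraticTwist (show ((s : ℤ) : ℚ) ≠ 0 by exact_mod_cast hs0)
  haveI : (W.quadraticTwist (D : ℚ)).IsElliptic := W.isElliptic_quadraticTwist hDQ
  have hW'W₁ : W₁.quadraticTwist (m : ℚ) = W.quadraticTwist (D : ℚ) := by
    rw [hW₁, quadraticTwist_quadraticTwist, hDm]; push_cast; ring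
  obtain ⟨Cd, hCd⟩ := hWd
  -- `Wd` is multiplicative at `ℓ₀` (unit twist of `W₁`)
  set vℤ : HeightOneSpectrum ℤ := (primesEquiv (R := ℤ)).symm ⟨ℓ₀, hℓ₀.out⟩ with hvℤ
  have hmultW₁ : W₁.HasMultiplicativeReductionAt vℤ :=
    (W₁.hasMultiplicativeReductionAtPrime_iff_hasMultiplicativeReductionAt_holds ⟨ℓ₀, hℓ₀.out⟩).mp hmult₀
  have hmult' : (W₁.quadraticTwist (m : ℚ)).HasMultiplicativeReductionAt vℤ :=
    ((W₁.hasReductionAt_quadraticTwist_iff_of_not_dvd vℤ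
      (by rw [hvℤ, Literature.NumberTheory.EllipticCurves.Rat.natGenerator_primesEquiv_symm]; exact hℓ₀2) (d := m)
      (by rw [hvℤ, Literature.NumberTheory.EllipticCurves.Rat.natGenerator_primesEquiv_symm]; exact hℓ₀m)).2.1).mpr hmultW₁
  haveI : (W₁.quadraticTwist (m : ℚ)).IsElliptic := W₁.isElliptic_quadraticTwist hmQ
  have hmultD : (W.quadraticTwist (D : ℚ)).HasMultiplicativeReductionAtPrime ℓ₀ := by
    rw [← hW'W₁]
    exact ((W₁.quadraticTwist (m : ℚ)).hasMultiplicativeReductionAtPrime_iff_hasMultiplicativeReductionAt_holds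
      ⟨ℓ₀, hℓ₀.out⟩).mpr hmult'
  have hmultWd : Wd.HasMultiplicativeReductionAtPrime ℓ₀ := by
    rw [← hCd, hasMultiplicativeReductionAtPrime_smul_iff]; exact hmultD
  refine ⟨hmultWd, ?_⟩
  -- `Wd^{(m)} ≅ W₁`: `(Cd • E^{(D)})^{(m)} = C₁ • E^{(s·m·m)} = C₁ • C₂ • W₁`
  obtain ⟨C₂, hC₂⟩ := W₁.exists_variableChange_smul_eq_quadraticTwist_sq (θ := (m : ℚ)) hmQ
  have hWdm : Wd.quadraticTwist (m : ℚ) =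
      ((⟨Cd.u, (m : ℚ) * Cd.r, 0, 0⟩ : VariableChange ℚ) * C₂) • W₁ := by
    rw [← hCd, WeierstrassCurve.quadraticTwist_smul, mul_smul, hC₂, hW₁, quadraticTwist_quadraticTwist,
      quadraticTwist_quadraticTwist, hDm]
    push_cast
    ring_nf
  have hsplit_m : (Wd.quadraticTwist (m : ℚ)).HasSplitMultiplicativeReductionAtPrime ℓ₀ ↔
      W₁.HasSplitMultiplicativeReductionAtPrime ℓ₀ := by
    rw [hWdm, hasSplitMultiplicativeReductionAtPrime_smul_iff]
  -- the unit-twist law at the place `w` over `ℓ₀`, for the globally minimal `Wd`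
  have hmultWd_w : Wd.HasMultiplicativeReductionAt w := (hasMultiplicativeReductionAtPrime_primesEquiv_iff_holds Wd w ℓ₀ hw).mp hmultWd
  have hw2 : (primesEquiv w : ℕ) ≠ 2 := by rw [hw]; exact hℓ₀2
  have hwm : ¬ ((primesEquiv w : ℕ) : ℤ) ∣ m := by rw [hw]; exact hℓ₀m
  obtain ⟨-, -, key⟩ :=
    AdditivePotMult.hasMultiplicativeReductionAt_and_split_iff_quadraticTwist_of_not_dvd Wd w hw2 hwm hmultWd_w
  -- translate the place statements into `AtPrime` statements at `ℓ₀`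
  haveI : (Wd.quadraticTwist (m : ℚ)).IsElliptic := Wd.isElliptic_quadraticTwist hmQ
  have e1 : (Wd.quadraticTwist (m : ℚ)).HasSplitMultiplicativeReductionAt w ↔
      (Wd.quadraticTwist (m : ℚ)).HasSplitMultiplicativeReductionAtPrime ℓ₀ := by
    rw [← (Wd.quadraticTwist (m : ℚ)).hasSplitMultiplicativeReductionAtPrime_iff_hasSplitMultiplicativeReductionAt w]
    subst hw
    rfl
  have e2 : Wd.HasSplitMultiplicativeReductionAt w ↔ Wd.HasSplitMultiplicativeReductionAtPrime ℓ₀ := by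
    rw [← Wd.hasSplitMultiplicativeReductionAtPrime_iff_hasSplitMultiplicativeReductionAt w]
    subst hw
    rfl
  have e3 : IsSquare ((m : ℤ) : ZMod (primesEquiv w : ℕ)) ↔ IsSquare ((m : ℤ) : ZMod ℓ₀) := by subst hw; rfl
  rw [e1, hsplit_m, e3, e2] at key
  -- `key : W₁ split ↔ (m̄ square ↔ Wd split)`; the class clause says `m̄ square ↔ ¬ W₁ split`
  have hm_ne : ((m : ℤ) : ZMod ℓ₀) ≠ 0 := fun h ↦ hℓ₀m ((ZMod.intCast_zmod_eq_zero_iff_dvd m ℓ₀).mp h)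
  have hclass' : legendreSym ℓ₀ m = (if W₁.HasSplitMultiplicativeReductionAtPrime ℓ₀ then -1 else 1) := by
    rw [hm, hD, hs]; exact hclass
  by_cases hs₁ : W₁.HasSplitMultiplicativeReductionAtPrime ℓ₀
  · -- case B: `(m/ℓ₀) = −1`, `m̄` not a square; `W₁` split forces `m̄ square ↔ Wd split`, so `Wd` is not split
    rw [if_pos hs₁] at hclass'
    have hnsq : ¬ IsSquare ((m : ℤ) : ZMod ℓ₀) := (legendreSym.eq_neg_one_iff ℓ₀).mp hclass'
    intro hWd
    exact hnsq ((key.mp hs₁).mpr hWd)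
  · -- case A: `(m/ℓ₀) = +1`, `m̄` a square; `W₁` not split forces `¬ (m̄ square ↔ Wd split)`, so `Wd` is not split
    rw [if_neg hs₁] at hclass'
    have hsq : IsSquare ((m : ℤ) : ZMod ℓ₀) := (legendreSym.eq_one_iff ℓ₀ hm_ne).mp hclass'
    intro hWd
    exact hs₁ (key.mpr (iff_of_true hsq hWd))

/-- **`w(E^{(d_K)}) = −w(E)` for EVERY twisted road field (`E` not additive at `2`)** — the sketch's `EngineTwisted` on the odd rows:
for `E / ℚ` (global minimal `W`, modular, odd additive primes of quadratic-twist type, NOT additive at `2`), an odd prime `ℓ₀` at which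
`E` is additive and `W₁ = E^{(ℓ₀*)}` multiplicative, and an imaginary quadratic `K` with `ℓ₀ ∣ d_K` IN THE NON-SPLIT CLASS
(`(d_K/ℓ₀* / ℓ₀) = −1` or `+1` according as `W₁` is split or not), every bad prime `≠ ℓ₀` of `E` split in `K` and `2` split when
`2 ∤ N_E`: `w(E^{(d_K)}) = −w(E)`. Both classes: the field unpacking of p796997 and the class clause in geometric form fed to the
both-classes engine p796897. [cite: AtkinLi1978, §1 and §3] [cite: Rohrlich1993Compositio, Prop. 2 (ii)–(iii) and Prop. 3]
[cite: SilvermanAEC2009, Ex. 10.16 and X.5 Cor. 5.4] -/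
theorem rootNumber_quadraticTwist_discr_eq_neg_of_twistedRoadField (hmod : exists_isNewformOf)
    (htt : ∀ p : Nat.Primes, (p : ℕ) ≠ 2 → W.HasAdditiveReductionAt ((primesEquiv (R := ℤ)).symm p) →
      ¬ (W.quadraticTwist (((-1 : ℤ) ^ ((p : ℕ) / 2) * p : ℤ) : ℚ)).HasAdditiveReductionAt
        ((primesEquiv (R := ℤ)).symm p))
    (h2 : ¬ W.HasAdditiveReductionAt ((primesEquiv (R := ℤ)).symm ⟨2, Nat.prime_two⟩))
    {ℓ₀ : ℕ} [hℓ₀ : Fact ℓ₀.Prime] (hℓ₀2 : ℓ₀ ≠ 2)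
    (hadd₀ : W.HasAdditiveReductionAt ((primesEquiv (R := ℤ)).symm ⟨ℓ₀, hℓ₀.out⟩))
    (hmult₀ : (W.quadraticTwist (((-1 : ℤ) ^ (ℓ₀ / 2) * ℓ₀ : ℤ) : ℚ)).HasMultiplicativeReductionAtPrime ℓ₀)
    (K : Type) [Field K] [NumberField K] (hK : IsImaginaryQuadratic K)
    (hℓ₀K : (ℓ₀ : ℤ) ∣ NumberField.discr K)
    (hclass : legendreSym ℓ₀ (NumberField.discr K / ((-1 : ℤ) ^ (ℓ₀ / 2) * ℓ₀)) =
      (if (W.quadraticTwist (((-1 : ℤ) ^ (ℓ₀ / 2) * ℓ₀ : ℤ) : ℚ)).HasSplitMultiplicativeReductionAtPrime ℓ₀ then -1 else 1))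
    (hsplit : ∀ r : ℕ, r.Prime → r ∣ W.conductorNorm ℤ → r ≠ ℓ₀ → ((Ideal.span {(r : ℤ)}).primesOver (𝓞 K)).ncard = 2)
    (h2split : ¬ 2 ∣ W.conductorNorm ℤ → ((Ideal.span {(2 : ℤ)}).primesOver (𝓞 K)).ncard = 2) :
    (W.quadraticTwist (NumberField.discr K : ℚ)).rootNumber = -W.rootNumber := by
  set D : ℤ := NumberField.discr K with hD
  set s : ℤ := (-1 : ℤ) ^ (ℓ₀ / 2) * ℓ₀ with hs
  have h2K : Module.finrank ℚ K = 2 := hK.1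
  have hDneg : D < 0 := hK.discr_neg
  have hDQ : (D : ℚ) ≠ 0 := by exact_mod_cast NumberField.discr_ne_zero K
  -- `2` splits in `K`, so `d_K ≡ 1 (mod 8)`; `d_K` is odd fundamental, square-free
  have h2spl : ((Ideal.span {(2 : ℤ)}).primesOver (𝓞 K)).ncard = 2 := by
    by_cases h2N : 2 ∣ W.conductorNorm ℤ
    · have h := hsplit 2 Nat.prime_two h2N (Ne.symm hℓ₀2)
      simpa using h
    · exact h2split h2N
  have h8 : D % 8 = 1 := (Quadratic.ncard_primesOver_two_eq_two_iff h2K).mp h2spl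
  have hsqD : Squarefree D := by
    rcases Quadratic.isFundamentalDiscriminant_discr (K := K) h2K with ⟨-, hsq, -⟩ | ⟨h4, -, -⟩
    · exact hsq
    · exfalso
      obtain ⟨c, hc⟩ := h4
      omega
  -- `d_K = ℓ₀* · m`
  have hsD : s ∣ D := ((isUnit_neg_one (α := ℤ)).pow (ℓ₀ / 2)).mul_left_dvd.mpr hℓ₀K
  set m : ℤ := D / s with hm
  have hDm : D = s * m := (Int.mul_ediv_cancel' hsD).symm
  have hmsq : Squarefree m := hsqD.squarefree_of_dvd ⟨s, by rw [hDm, mul_comm]⟩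
  have hℓ₀m : ¬ (ℓ₀ : ℤ) ∣ m := by
    rintro ⟨t, ht⟩
    have hsq : ((ℓ₀ : ℕ) : ℤ) ^ 2 ∣ NumberField.discr K := by
      refine ⟨(-1 : ℤ) ^ (ℓ₀ / 2) * t, ?_⟩
      rw [← hD, hDm, ht, hs]; ring
    exact Quadratic.not_sq_dvd_discr_of_prime_ne_two h2K hℓ₀.out hℓ₀2 hsq
  -- the primes of `m` are ramified in `K`, hence not split, hence good primes of `E`
  have hgood : ∀ r : Nat.Primes, ((r : ℕ) : ℤ) ∣ m → W.HasGoodReductionAt ((primesEquiv (R := ℤ)).symm r) := by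
    intro r hr
    haveI := Fact.mk r.2
    have hrD : ((r : ℕ) : ℤ) ∣ D := by rw [hDm]; exact hr.mul_left _
    have hr2 : (r : ℕ) ≠ 2 := by
      intro h
      rw [h] at hrD
      have : (2 : ℤ) ∣ D := by exact_mod_cast hrD
      omega
    have hrℓ : (r : ℕ) ≠ ℓ₀ := fun h ↦ hℓ₀m (by rw [← h]; exact hr)
    have hnsplit : ((Ideal.span {((r : ℕ) : ℤ)}).primesOver (𝓞 K)).ncard ≠ 2 := by
      intro h
      have h1 := (Quadratic.ncard_primesOver_eq_two_iff_legendreSym h2K hr2).mp h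
      rw [(legendreSym.eq_zero_iff (r : ℕ) (NumberField.discr K)).mpr
        ((ZMod.intCast_zmod_eq_zero_iff_dvd _ _).mpr (by rw [← hD]; exact hrD))] at h1
      exact zero_ne_one h1
    have hrN : ¬ (r : ℕ) ∣ W.conductorNorm ℤ := fun h ↦ hnsplit (hsplit r r.2 h hrℓ)
    by_contra hbad
    exact hrN ((W.dvd_conductorNorm_iff_not_hasGoodReductionAtPrime r).mpr
      (fun hg ↦ hbad ((W.hasGoodReductionAtPrime_iff_hasGoodReductionAt_holds r).mp hg)))
  -- the odd bad primes `≠ ℓ₀` split: `(d_K/v) = 1`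
  have hjac : ∀ p : ℕ, p.Prime → p ∣ W.conductorNorm ℤ → p ≠ 2 → p ≠ ℓ₀ → jacobiSym D p = 1 := fun p hp hpN hp2 hpℓ ↦
    (Quadratic.ncard_primesOver_eq_two_iff_jacobiSym h2K hp hp2).mp (hsplit p hp hpN hpℓ)
  -- the class clause, geometric form: a globally minimal model of `E^{(d_K)}` is not split at `ℓ₀`
  obtain ⟨Wd, iWd, iWdm, Cd, hCd⟩ := exists_isGloballyMinimal_smul_eq_quadraticTwist W hDQ
  have hWd : Cd⁻¹ • W.quadraticTwist (D : ℚ) = Wd := by rw [← hCd, inv_smul_smul]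
  obtain ⟨-, hnsWd⟩ := quadraticTwist_discr_nonsplit_at_of_nonsplitClass W hℓ₀2 hmult₀ K hK hℓ₀K hclass Wd ⟨Cd⁻¹, hWd⟩
  haveI : (W.quadraticTwist (D : ℚ)).IsElliptic := W.isElliptic_quadraticTwist hDQ
  have hnsD : ¬ (W.quadraticTwist (D : ℚ)).HasSplitMultiplicativeReductionAtPrime ℓ₀ := by
    rw [← hCd, hasSplitMultiplicativeReductionAtPrime_smul_iff]; exact hnsWd
  exact rootNumber_quadraticTwist_eq_neg_of_potMult_nonsplit W hmod htt h2 hℓ₀2 hadd₀ hmult₀ hDm h8 hDneg hmsq hℓ₀m hgood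
    hjac hnsD

end Summit.BirchSwinnertonDyer.BirchSwinnertonDyer.Theorems.TwistRootNumberTwisted

end
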